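import Summits.Ventures.HSemireg.WedgeHankelRecurrenceHankelDeterminant
import Literature.Algebra.Polynomial.Subresultant

/-!
# Venture HSemireg — THE LEADING HANKEL MINORS OF `Q/P` ARE THE SUBRESULTANTS: for `P` monic of degree `p = j + t + 1` and `Q` of degree `q = j + b ≤ p` (`b ≤ t + 1`),
# **`det (dualSeq P Q (i + i'))_{i,i' ≤ t} = sign(reversal of t + 1 letters) · σ_j(P, Q)`** — the `(t+1) × (t+1)` leading principal minor of the Hankel matrix of the moments of `Q/P` is, up to
# the sign `(−1)^{t(t+1)/2}`, von zur Gathen–Gerhard's subresultant `σ_j = det S_j` (BPR Lemma 9.26 `sRes_{p−k}(P, Q) = a_p^{2k+2−p+q} han(s̄_k)` for monic `P`, in the tree's unsigned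
# convention; `j = 0` is the tree's Kronecker–Hermite `det H_{p−1}(Q/P) = sign · Res(P, Q)`, N111)

HONEST FRAMING. Part of the Lean index of the computation cell `pub-hsemireg` (seat p10 gen 36, Sunday typer «UNIFORM-IN-n»).
LINEAR ALGEBRA OF HANKEL ∕ SYLVESTER-TYPE MATRICES AND POLYNOMIALS OVER A FIELD ONLY (PROVED Literature `Algebra/Polynomial/Subresultant` — `subresultant`, `subresultant_eq_det` — and
`Algebra/Polynomial/CofactorResultantBound` — `sylvesterShift`, `sylvesterShift_apply_castAdd ∕ _natAdd` — IMPORTED): no variety, no cohomology theory, no sheaf, no Ext group and no semiregularity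
map is constructed here; nothing here says that HC / HC_CM / HC_AV holds; no Literature fact (unproved `Prop`) is declared or used.  Custodian versions as in `WedgeHankelSiegelIdeal` (1/3).
SOURCE OF THE ARGUMENT (cited; held text read, `book:basu2006-algorithms-real-algebraic-geometry` p. 366): S. Basu, R. Pollack, M.-F. Roy, *Algorithms in Real Algebraic Geometry* (2006) §9.2.2
**Lemma 9.26** «For all `k ∈ {1, …, p}`, `sRes_{p−k}(P, Q) = a_p^{2k+2−p+q} han(s̄_k)`»; J. von zur Gathen, J. Gerhard, *Modern Computer Algebra* (1999) §6.10 (the matrix `S_k` and `σ_k = det S_k`,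
typed in the Literature module).  The proof here is NOT BPR's (relations (9.6) with the matrices `Δ`, `D`, `D′`) but a direct block elimination: in `S_j` replace each column `X^c Q` (`c ≤ t`) by its
residue `X^c Q mod P` — a column operation by the monic columns `X^l P` (`l < b`), determinant unchanged — after which the matrix is block upper-triangular with a unipotent `P`-block, so
`σ_j(P, Q) = det ([X^{j+i}](X^c Q mod P))_{i,c ≤ t}`; and the Hankel block factors as `H_t(Q/P) = H_t(c_{j+·}) · ([X^{j+i}](X^c Q mod P))` with `c = charSeq P` (the moments of `1/P`), whose
first factor is anti-unitriangular of determinant `sign(reversal)` (N73's argument for `j = 0`).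
DEDUP DISCLOSURE (`rg` of the whole tree + Mathlib, 2026-09-01): N73 ∕ N111 give the FULL-size determinant `det H_{p−1}(a/m) = sign · N(a) = sign · Res(m, a)`; N138 ∕ N139 ∕ N143 (Jacobi,
Gundelfinger) read signatures from the leading minors `D_k` WITHOUT identifying them; Literature `Subresultant` has `σ_0 = Res`, `σ_{deg g} = lc(g)^{n−m}`, `InDegSeq ⟺ σ_k ≠ 0`; NO file in the
tree identifies a Hankel leading minor of `Q/P` with a subresultant — that is this file.  9 names: 0 hits tree-wide.

WHAT IS IN THE TREE.  N73 (`…HankelDeterminant`): `charSeq_apply_of_le` (`c_n = [n = p − 1]` for `n ≤ p − 1`), `mulResidueMat`, `hankelSq_dualSeq_eq_mul`; N32 `dualSeq`, `dualSeq_X_pow_mul`,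
`dualSeq_modByMonic`, `dualSeq_eq_hkFun_charSeq`; N31 `hkFun_eq_sum_range`; N48 `hankelSq`; Literature `Subresultant`: `subresultant f g k`, `subresultant_eq_det` (`σ_k = det (sylvesterShift f g k a b)`
for `a = deg f − k`, `b = deg g − k`), `CofactorResultantBound.sylvesterShift` (`(i, castAdd c) ↦ [X^{k+i}](X^c g)`, `(i, natAdd l) ↦ [X^{k+i}](X^l f)`).  Mathlib: `Matrix.det_fromBlocks_zero₂₁`,
`Matrix.det_of_upperTriangular`, `Matrix.det_submatrix_equiv_self`, `finSumFinEquiv`, `Fin.sum_univ_add`, `Polynomial.modByMonic_add_div`, `natDegree_divByMonic`, `as_sum_range'`, `coeff_X_pow_mul'`.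
THIS FILE (namespace `Summit.Ventures.HSemireg.Wedge.HankelOuter` continued; PLAIN on N73 + Literature `Subresultant`; 0 definitions):
* §783 THE ELIMINATION: `coeff_X_pow_mul_eq_coeff_modByMonic_add_sum` (`[X^d](X^c Q) = [X^d](X^c Q mod P) + Σ_{l<b} [X^d](X^l P)·u_{c,l}`, `u_c = (X^c Q) div P` of degree `< b`), `degree_X_pow_mul_divByMonic_lt`, **`det_sylvesterShift_eq_det_coeff_modByMonic`**
  (`σ_j`'s matrix has the determinant of the `(t+1) × (t+1)` residue block `([X^{j+i}](X^c Q mod P))_{i,c ≤ t}`).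
* §784 THE HANKEL BLOCK: `hankelSq_charSeq_shift_apply_of_le` (`c_{j+n} = [n = t]`, `n ≤ t`), `det_hankelSq_charSeq_shift` (`= sign(reversal)`), **`hankelSq_dualSeq_eq_mul_coeff_modByMonic`** (`H_t(Q/P) =
  H_t(c_{j+·}) · residue block`).
* §785 THE THEOREM: **`det_hankelSq_dualSeq_eq_sign_mul_subresultant`** (`det H_t(Q/P) = sign(reversal) · σ_j(P, Q)`, `P` monic of degree `j + t + 1`, `deg Q = j + b`, `b ≤ t + 1`),
  `subresultant_ne_zero_iff_det_hankelSq_ne_zero`, `inDegSeq_iff_det_hankelSq_ne_zero` (Literature Cor. 6.49 (i): `j` is a remainder degree ⟺ the `(p−j)`-th Hankel minor `≠ 0`).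
CAVEATS.  `P` MONIC (BPR's `a_p^{2k+2−p+q}` is then `1`); the tree's `subresultant` is von zur Gathen–Gerhard's UNSIGNED `σ_j` (BPR's signed `sRes_j` differs by the sign conventions of §8.3,
not typed here); the Hankel minor has size `t + 1 ≥ p − q` (for smaller sizes the minors of `Q/P` vanish trivially and `σ_j` is not defined by the book); `deg Q ≤ deg P`.
Nothing Ext-side.  New names only.
-/

open Module Polynomial
open scoped Matrix Polynomial

namespace Summit.Ventures.HSemireg.Wedge.HankelOuter

open Summit.Ventures.HSemireg.Wedge Summit.Ventures.HSemireg.Wedge.Hankel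
open Literature.Algebra.Polynomial.Subresultant (subresultant subresultant_eq_det)
open Literature.Algebra.Polynomial.CofactorResultantBound (sylvesterShift sylvesterShift_apply_castAdd sylvesterShift_apply_natAdd)

variable (K : Type*) [Field K]

/-! ## §783. Eliminating the `Q`-columns of `S_j` modulo the monic `P` -/

/-- **`[X^d](X^c Q) = [X^d](X^c Q mod P) + Σ_{l < b} [X^d](X^l P) · [X^l]((X^c Q) div P)`** whenever the quotient `(X^c Q) div P` has degree `< b` (any `P`; Mathlib's `modByMonic_add_div`): the column `X^c Q` of `S_j` is
its residue column plus a combination of the `P`-columns. [this file, §783] -/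
theorem coeff_X_pow_mul_eq_coeff_modByMonic_add_sum {P : K[X]} (Q : K[X]) (c d : ℕ) {b : ℕ} (hb : ((Polynomial.X ^ c * Q) /ₘ P).degree < b) :
    (Polynomial.X ^ c * Q).coeff d = (Polynomial.X ^ c * Q %ₘ P).coeff d + ∑ l : Fin b, (Polynomial.X ^ (l : ℕ) * P).coeff d * ((Polynomial.X ^ c * Q) /ₘ P).coeff (l : ℕ) := by
  set u := (Polynomial.X ^ c * Q) /ₘ P with hu
  have hdiv : Polynomial.X ^ c * Q = Polynomial.X ^ c * Q %ₘ P + u * P := by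
    rw [hu, mul_comm (Polynomial.X ^ c * Q /ₘ P) P, Polynomial.modByMonic_add_div (Polynomial.X ^ c * Q) P]
  have huP : u * P = ∑ l : Fin b, C (u.coeff (l : ℕ)) * (Polynomial.X ^ (l : ℕ) * P) := by
    by_cases hu0 : u = 0
    · rw [hu0, zero_mul]; exact (Finset.sum_eq_zero fun l _ => by rw [coeff_zero, C_0, zero_mul]).symm
    · have hnb : u.natDegree < b := by
        have h := hb; rw [degree_eq_natDegree hu0] at h; exact_mod_cast h
      conv_lhs => rw [as_sum_range' u b hnb, Finset.sum_mul, ← Fin.sum_univ_eq_sum_range]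
      exact Finset.sum_congr rfl fun l _ => by rw [← C_mul_X_pow_eq_monomial]; ring
  conv_lhs => rw [hdiv, huP]
  rw [coeff_add, finsetSum_coeff]
  congr 1
  exact Finset.sum_congr rfl fun l _ => by rw [coeff_C_mul, mul_comm]

/-- The quotient `(X^c Q) div P` has degree `< b` when `P` is monic of degree `j + t + 1`, `deg Q ≤ j + b`, `c ≤ t`. [bookkeeping] -/
theorem degree_X_pow_mul_divByMonic_lt {j t b : ℕ} {P : K[X]} (hP : P.Monic) (hPd : P.natDegree = j + t + 1) {Q : K[X]} (hQd : Q.natDegree ≤ j + b) {c : ℕ} (hc : c ≤ t) :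
    ((Polynomial.X ^ c * Q) /ₘ P).degree < b := by
  by_cases hQ0 : Q = 0
  · rw [hQ0, mul_zero, zero_divByMonic, degree_zero]; exact WithBot.bot_lt_coe b
  by_cases hlt : (Polynomial.X ^ c * Q).degree < P.degree
  · rw [(divByMonic_eq_zero_iff hP).2 hlt, degree_zero]; exact WithBot.bot_lt_coe b
  · have hn : ((Polynomial.X ^ c * Q) /ₘ P).natDegree < b := by
      rw [natDegree_divByMonic _ hP, natDegree_X_pow_mul (n := c) hQ0, hPd]
      have : j + t + 1 ≤ Q.natDegree + c := by
        rw [not_lt, degree_eq_natDegree hP.ne_zero, degree_eq_natDegree (mul_ne_zero (pow_ne_zero _ X_ne_zero) hQ0), natDegree_X_pow_mul (n := c) hQ0, hPd] at hlt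
        exact_mod_cast hlt
      omega
    exact (degree_le_natDegree).trans_lt (by exact_mod_cast hn)

/-- **THE ELIMINATION: `det S_j(P, Q) = det ([X^{j+i}](X^c Q mod P))_{i, c ≤ t}`** for `P` monic of degree `j + t + 1` and `deg Q ≤ j + b`, where `S_j` is the tree's `sylvesterShift P Q j (t + 1) b`
(columns `X^c Q`, `c ≤ t`, and `X^l P`, `l < b`, cut to the degrees `j, …, j + t + b`): replacing every `Q`-column by its residue modulo `P` is a column operation by the `P`-columns
(`S_j = [[M, A], [0, U]] · [[1, 0], [N, 1]]` after re-indexing along `Fin (t+1) ⊕ Fin b`), the rows of degree `≥ p` vanish on the residue columns and the `P`-block `U` is upper unitriangular.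
[this file, §783] -/
theorem det_sylvesterShift_eq_det_coeff_modByMonic {j t b : ℕ} {P : K[X]} (hP : P.Monic) (hPd : P.natDegree = j + t + 1) {Q : K[X]} (hQd : Q.natDegree ≤ j + b) :
    (sylvesterShift P Q j (t + 1) b).det = (Matrix.of fun i c : Fin (t + 1) => (Polynomial.X ^ (c : ℕ) * Q %ₘ P).coeff (j + (i : ℕ))).det := by
  set M : Matrix (Fin (t + 1)) (Fin (t + 1)) K := Matrix.of fun i c => (Polynomial.X ^ (c : ℕ) * Q %ₘ P).coeff (j + (i : ℕ)) with hM
  set A : Matrix (Fin (t + 1)) (Fin b) K := Matrix.of fun i l => (Polynomial.X ^ (l : ℕ) * P).coeff (j + (i : ℕ)) with hA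
  set U : Matrix (Fin b) (Fin b) K := Matrix.of fun i l => (Polynomial.X ^ (l : ℕ) * P).coeff (j + (t + 1 + (i : ℕ))) with hU
  set N : Matrix (Fin b) (Fin (t + 1)) K := Matrix.of fun l c => ((Polynomial.X ^ (c : ℕ) * Q) /ₘ P).coeff (l : ℕ) with hN
  have hm1 : P ≠ 1 := fun h => by rw [h, natDegree_one] at hPd; omega
  -- the re-indexed `S_j` is the product of the two block matrices
  have hT : (sylvesterShift P Q j (t + 1) b).submatrix finSumFinEquiv finSumFinEquiv = Matrix.fromBlocks M A 0 U * Matrix.fromBlocks 1 0 N 1 := by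
    rw [Matrix.fromBlocks_multiply]
    simp only [Matrix.mul_one, Matrix.mul_zero, zero_add]
    ext r cc
    rcases r with i | i <;> rcases cc with c | l
    · -- (1,1): `[X^{j+i}](X^c Q) = M + A N`
      rw [Matrix.submatrix_apply, finSumFinEquiv_apply_left, finSumFinEquiv_apply_left, sylvesterShift_apply_castAdd, Matrix.fromBlocks_apply₁₁, Matrix.add_apply, Matrix.mul_apply,
        ← coeff_X_pow_mul', Fin.val_castAdd, coeff_X_pow_mul_eq_coeff_modByMonic_add_sum K Q c (j + (i : ℕ)) (degree_X_pow_mul_divByMonic_lt K hP hPd hQd (Nat.le_of_lt_succ c.isLt))]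
      simp only [hM, hA, hN, Matrix.of_apply]
    · -- (1,2): the `P`-columns
      rw [Matrix.submatrix_apply, finSumFinEquiv_apply_left, finSumFinEquiv_apply_right, sylvesterShift_apply_natAdd, Matrix.fromBlocks_apply₁₂, hA, Matrix.of_apply, ← coeff_X_pow_mul', Fin.val_castAdd]
    · -- (2,1): `[X^{p+i}](X^c Q) = 0 + U N` (the residue has degree `< p`)
      rw [Matrix.submatrix_apply, finSumFinEquiv_apply_right, finSumFinEquiv_apply_left, sylvesterShift_apply_castAdd, Matrix.fromBlocks_apply₂₁, Matrix.mul_apply, ← coeff_X_pow_mul',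
        Fin.val_natAdd, coeff_X_pow_mul_eq_coeff_modByMonic_add_sum K Q c (j + (t + 1 + (i : ℕ))) (degree_X_pow_mul_divByMonic_lt K hP hPd hQd (Nat.le_of_lt_succ c.isLt)),
        coeff_eq_zero_of_natDegree_lt ((natDegree_modByMonic_lt _ hP hm1).trans_le (by rw [hPd]; omega)), zero_add]
      simp only [hU, hN, Matrix.of_apply]
    · -- (2,2)
      rw [Matrix.submatrix_apply, finSumFinEquiv_apply_right, finSumFinEquiv_apply_right, sylvesterShift_apply_natAdd, Matrix.fromBlocks_apply₂₂, hU, Matrix.of_apply, ← coeff_X_pow_mul', Fin.val_natAdd]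
  -- `U` is upper unitriangular
  have hUtri : U.BlockTriangular id := fun i l hli => by
    simp only [hU, Matrix.of_apply, coeff_X_pow_mul']
    have hli' : (l : ℕ) < i := hli
    rw [if_pos (by omega), coeff_eq_zero_of_natDegree_lt (by rw [hPd]; omega)]
  have hUdiag : ∀ i : Fin b, U i i = 1 := fun i => by
    simp only [hU, Matrix.of_apply, coeff_X_pow_mul']
    rw [if_pos (by omega), show j + (t + 1 + (i : ℕ)) - (i : ℕ) = P.natDegree by rw [hPd]; omega]
    exact hP.coeff_natDegree
  have hdetU : U.det = 1 := by rw [Matrix.det_of_upperTriangular hUtri, Finset.prod_eq_one fun i _ => hUdiag i]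
  rw [← Matrix.det_submatrix_equiv_self finSumFinEquiv, hT, Matrix.det_mul, Matrix.det_fromBlocks_zero₂₁, Matrix.det_fromBlocks_zero₁₂, Matrix.det_one, Matrix.det_one, hdetU]
  ring

/-! ## §784. The leading Hankel block of `Q/P` factors through the residue block -/

/-- `H_t(c_{j+·})_{i,i'} = [i + i' = t]` for `i + i' ≤ t` (`c = charSeq P` the moments of `1/P`, `P` monic of degree `j + t + 1`: `c_n = [X^{p−1}](X^n mod P) = [n = p − 1]` for `n ≤ p − 1`).
[this file, §784] -/
theorem hankelSq_charSeq_shift_apply_of_le {j t : ℕ} {P : K[X]} (hP : P.Monic) (hPd : P.natDegree = j + t + 1) (i i' : Fin (t + 1)) (h : (i : ℕ) + i' ≤ t) :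
    hankelSq K t (fun n => charSeq K P (j + n)) i i' = if (i : ℕ) + i' = t then 1 else 0 := by
  rw [hankelSq, Matrix.of_apply, charSeq_apply_of_le K hP hPd (by omega)]
  by_cases hit : (i : ℕ) + i' = t
  · rw [if_pos (by omega), if_pos hit]
  · rw [if_neg (by omega), if_neg hit]

/-- **`det H_t(c_{j+·}) = sign(reversal of t + 1 letters)`** (anti-unitriangular; N73's argument for `j = 0`). [this file, §784] -/
theorem det_hankelSq_charSeq_shift {j t : ℕ} {P : K[X]} (hP : P.Monic) (hPd : P.natDegree = j + t + 1) :
    (hankelSq K t (fun n => charSeq K P (j + n))).det = Equiv.Perm.sign (Fin.revPerm : Equiv.Perm (Fin (t + 1))) := by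
  set U : Matrix (Fin (t + 1)) (Fin (t + 1)) K := (hankelSq K t (fun n => charSeq K P (j + n))).submatrix id Fin.revPerm with hU
  have hback : hankelSq K t (fun n => charSeq K P (j + n)) = U.submatrix id Fin.revPerm := by
    ext i i'
    simp only [hU, Matrix.submatrix_apply, id, Fin.revPerm_apply, Fin.rev_rev]
  have hlow : U.BlockTriangular OrderDual.toDual := by
    intro i i' hii'
    have hii'' : (i : ℕ) < i' := hii'
    have h := hankelSq_charSeq_shift_apply_of_le K hP hPd i (Fin.rev i') (by rw [Fin.val_rev]; omega)
    rw [if_neg (by rw [Fin.val_rev]; omega)] at h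
    simpa only [hU, Matrix.submatrix_apply, id, Fin.revPerm_apply] using h
  have hdiag : ∀ i : Fin (t + 1), U i i = 1 := fun i => by
    have h := hankelSq_charSeq_shift_apply_of_le K hP hPd i (Fin.rev i) (by rw [Fin.val_rev]; omega)
    rw [if_pos (by rw [Fin.val_rev]; omega)] at h
    simpa only [hU, Matrix.submatrix_apply, id, Fin.revPerm_apply] using h
  rw [hback, Matrix.det_permute', Matrix.det_of_lowerTriangular U hlow, Finset.prod_eq_one fun i _ => hdiag i, mul_one]

/-- **`H_t(Q/P) = H_t(c_{j+·}) · ([X^{j+i}](X^c Q mod P))_{i,c ≤ t}`** for `P` monic of degree `j + t + 1` (the `(t+1) × (t+1)` LEADING block of Barnett's factorisation `H_{p−1}(Q/P) = H_{p−1}(1/P) · M_Q`,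
N73: the moments `c_{i+k}` vanish for `k < j` when `i ≤ t`). [this file, §784] -/
theorem hankelSq_dualSeq_eq_mul_coeff_modByMonic {j t : ℕ} {P : K[X]} (hP : P.Monic) (hPd : P.natDegree = j + t + 1) (Q : K[X]) :
    hankelSq K t (dualSeq K P Q) = hankelSq K t (fun n => charSeq K P (j + n)) * Matrix.of fun i c : Fin (t + 1) => (Polynomial.X ^ (c : ℕ) * Q %ₘ P).coeff (j + (i : ℕ)) := by
  ext i c
  have hm1 : P ≠ 1 := fun h => by rw [h, natDegree_one] at hPd; omega
  have hdeg : (Polynomial.X ^ (c : ℕ) * Q %ₘ P).natDegree < j + (t + 1) := (natDegree_modByMonic_lt _ hP hm1).trans_eq (by rw [hPd]; ring)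
  rw [Matrix.mul_apply, hankelSq, Matrix.of_apply]
  calc dualSeq K P Q ((i : ℕ) + c) = dualSeq K P (Polynomial.X ^ (c : ℕ) * Q) i := (dualSeq_X_pow_mul K P Q c i).symm
    _ = dualSeq K P (Polynomial.X ^ (c : ℕ) * Q %ₘ P) i := (congrFun (dualSeq_modByMonic K hP _) i).symm
    _ = hkFun K (charSeq K P) i (Polynomial.X ^ (c : ℕ) * Q %ₘ P) := dualSeq_eq_hkFun_charSeq K P _ i
    _ = ∑ k ∈ Finset.range (j + (t + 1)), (Polynomial.X ^ (c : ℕ) * Q %ₘ P).coeff k * charSeq K P (k + i) := hkFun_eq_sum_range K _ _ hdeg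
    _ = ∑ k ∈ Finset.range (t + 1), (Polynomial.X ^ (c : ℕ) * Q %ₘ P).coeff (j + k) * charSeq K P (j + k + i) := by
        rw [Finset.range_add_eq_union, Finset.sum_union (Finset.disjoint_range_addLeftEmbedding _ _), Finset.sum_map]
        rw [Finset.sum_eq_zero fun k hk => ?_, zero_add]
        · rfl
        · have hk' : k < j := Finset.mem_range.1 hk
          rw [charSeq_apply_of_le K hP hPd (by omega : k + (i : ℕ) ≤ j + t), if_neg (by omega), mul_zero]
    _ = ∑ k : Fin (t + 1), Matrix.of (fun i i' : Fin (t + 1) => charSeq K P (j + ((i : ℕ) + i'))) i k * Matrix.of (fun i c : Fin (t + 1) => (Polynomial.X ^ (c : ℕ) * Q %ₘ P).coeff (j + (i : ℕ))) k c := by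
        rw [← Fin.sum_univ_eq_sum_range]
        exact Finset.sum_congr rfl fun k _ => by rw [Matrix.of_apply, Matrix.of_apply, mul_comm, show j + k + (i : ℕ) = j + ((i : ℕ) + k) by ring]

/-! ## §785. The theorem: leading Hankel minors of `Q/P` are subresultants -/

/-- **BPR LEMMA 9.26 (monic `P`, the tree's `σ`): `det H_t(Q/P) = sign(reversal of t + 1 letters) · σ_j(P, Q)`** for `P` monic of degree `j + t + 1` and `deg Q = j + b`, `b ≤ t + 1` — the
`(t+1) × (t+1)` leading principal minor of the Hankel matrix of the moments of `Q/P` is `(−1)^{t(t+1)/2}` times von zur Gathen–Gerhard's subresultant `σ_j = det S_j` (for `j = 0` this is the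
tree's `det H_{p−1}(Q/P) = sign · Res(P, Q)`, N111). [this file, §785] -/
theorem det_hankelSq_dualSeq_eq_sign_mul_subresultant {j t b : ℕ} {P : K[X]} (hP : P.Monic) (hPd : P.natDegree = j + t + 1) {Q : K[X]} (hQd : Q.natDegree = j + b) :
    (hankelSq K t (dualSeq K P Q)).det = Equiv.Perm.sign (Fin.revPerm : Equiv.Perm (Fin (t + 1))) * subresultant P Q j := by
  rw [hankelSq_dualSeq_eq_mul_coeff_modByMonic K hP hPd Q, Matrix.det_mul, det_hankelSq_charSeq_shift K hP hPd,
    subresultant_eq_det (k := j) (a := t + 1) (b := b) (by rw [hPd]; omega) (by rw [hQd]; omega), det_sylvesterShift_eq_det_coeff_modByMonic K hP hPd hQd.le]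

/-- **`σ_j(P, Q) ≠ 0 ⟺ det H_t(Q/P) ≠ 0`** (`P` monic of degree `j + t + 1`, `deg Q = j + b`): by the tree's Cor. 6.49 (i) (`inDegSeq_iff_subresultant_ne_zero`) the non-vanishing leading Hankel minors
of `Q/P` mark the degrees that occur in the Euclidean remainder sequence of `P` and `Q`. [this file, §785] -/
theorem subresultant_ne_zero_iff_det_hankelSq_ne_zero {j t b : ℕ} {P : K[X]} (hP : P.Monic) (hPd : P.natDegree = j + t + 1) {Q : K[X]} (hQd : Q.natDegree = j + b) :
    subresultant P Q j ≠ 0 ↔ (hankelSq K t (dualSeq K P Q)).det ≠ 0 := by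
  rw [det_hankelSq_dualSeq_eq_sign_mul_subresultant K hP hPd hQd, mul_ne_zero_iff]
  have hs : ((Equiv.Perm.sign (Fin.revPerm : Equiv.Perm (Fin (t + 1))) : ℤ) : K) ≠ 0 := by
    rcases Int.units_eq_one_or (Equiv.Perm.sign (Fin.revPerm : Equiv.Perm (Fin (t + 1)))) with h | h <;> rw [h] <;> simp
  exact ⟨fun h => ⟨hs, h⟩, fun h => h.2⟩

/-- **`j` appears in the degree sequence of the Euclidean algorithm for `(P, Q)` ⟺ the `(p−j) × (p−j)` leading Hankel minor of `Q/P` is non-zero** (`P` monic of degree `j + t + 1`,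
`Q ≠ 0` of degree `j + b`, `b ≤ t + 1`; Literature Cor. 6.49 (i) `inDegSeq_iff_subresultant_ne_zero` read through §785 — Kronecker's description of the degrees of the remainders by the Hankel
minors of the moments). [this file, §785] -/
theorem inDegSeq_iff_det_hankelSq_ne_zero {j t b : ℕ} {P : K[X]} (hP : P.Monic) (hPd : P.natDegree = j + t + 1) {Q : K[X]} (hQ : Q ≠ 0) (hQd : Q.natDegree = j + b) (hb : b ≤ t + 1) :
    Literature.Algebra.Polynomial.Subresultant.InDegSeq P Q j ↔ (hankelSq K t (dualSeq K P Q)).det ≠ 0 := by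
  rw [Literature.Algebra.Polynomial.Subresultant.inDegSeq_iff_subresultant_ne_zero hP.ne_zero hQ hPd hQd (by omega) (by omega),
    subresultant_ne_zero_iff_det_hankelSq_ne_zero K hP hPd hQd]

end Summit.Ventures.HSemireg.Wedge.HankelOuter
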